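import Literature.Topology.FourManifolds.CircleSurgery
import Literature.Topology.FourManifolds.TorusCoordinates
import Literature.Topology.FourManifolds.FibrewiseMorseFrame
import Mathlib.Analysis.SpecialFunctions.Trigonometric.InverseDeriv
import HarnessLib

/-!
# Straightening the angular map along a tube about a circle

Auxiliary file of helper `helper_bott_tube` of stub `helper_sliceGluing_bottRecognition` (fibred
Morse–Bott recognition of the polar tube), line `Sketch`, crux `SblfDescent.RungOne`.

(Crux item stmt-SmoothPoincare4-18531; skeleton `Cruxes/RungOne/Lines/Sketch.lean`.)

Let `ν₀ : 𝕊¹ × ℝ³ → X` be a tube about a circle `e` (`ν₀ (u, 0) = e u`) in a smooth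
`4`-manifold and `β : X → ℝ²` a smooth map with `β (e u) = u` and `‖β‖ = 1` on a neighbourhood
`U` of the circle ("angular map").  Read along the lifted tube, `A (t, x) = β (ν₀ (circlePt t, x))`
is a unit vector near the zero section, equal to `(cos 2πt, sin 2πt)` on it; the map
`Ψ₁ (t, x) = (t + arcsin(c(t, x))/2π, x)`, `c = cos 2πt · A₁ - sin 2πt · A₀` the sine of the angle
from `circlePt t` to `A (t, x)`, is smooth on a uniform tube, fixes the zero section, is
equivariant under `t ↦ t + 1`, has invertible differential along the zero section, and
STRAIGHTENS `β`: `A (t, x) = (cos 2πs, sin 2πs)` with `s = (Ψ₁ (t, x)).1`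
(`BottStraighten.exists_straighten`).  With the periodic tube inverse function theorem
(`helper_foldNF_tubeIFT`) this reparametrises the tube so that `β` becomes the angular
coordinate — the first step of the Morse–Bott chart about a critical circle (Hirsch 1976, Ch. 4
§5, tubular neighbourhoods; Banyaga–Hurtubise 2004, Thm. 2).

## References

* M. W. Hirsch, *Differential Topology*, GTM 33 (1976), Ch. 4 §5, Thm. 5.1. [HirschDT1976]
* A. Banyaga, D. E. Hurtubise, *A proof of the Morse–Bott Lemma*, Expo. Math. 22 (2004), Thm. 2.
  [BanyagaHurtubise2004]
-/

set_option linter.dupNamespace false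

noncomputable section

open scoped Manifold ContDiff Topology Real
open Set Function Filter Metric Literature.Topology.FourManifolds

namespace Summit.SmoothPoincare4.SmoothPoincare4.Cruxes.RungOne.Sketch

namespace BottStraighten

variable {X : Type} [TopologicalSpace X] [ChartedSpace (EuclideanSpace ℝ (Fin 4)) X]
  {e : Metric.sphere (0 : EuclideanSpace ℝ (Fin 2)) 1 → X}
  (ν₀ : CircleNbhd (𝓡 4) e) (β : X → EuclideanSpace ℝ (Fin 2))

/-- **The angular map read along the lifted tube**, `A (t, x) = β (ν₀ (circlePt t, x))`.
[folklore] -/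
def A (q : ℝ × EuclideanSpace ℝ (Fin 3)) : EuclideanSpace ℝ (Fin 2) := β (ν₀.toFun (circlePt q.1, q.2))

/-- The sine of the angle from `circlePt t` to `A (t, x)`. [folklore] -/
def sn (q : ℝ × EuclideanSpace ℝ (Fin 3)) : ℝ :=
  Real.cos (2 * π * q.1) * A ν₀ β q 1 - Real.sin (2 * π * q.1) * A ν₀ β q 0

/-- The cosine of the angle from `circlePt t` to `A (t, x)`. [folklore] -/
def cs (q : ℝ × EuclideanSpace ℝ (Fin 3)) : ℝ :=
  Real.cos (2 * π * q.1) * A ν₀ β q 0 + Real.sin (2 * π * q.1) * A ν₀ β q 1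

/-- The angle correction `h = arcsin(sn)/2π`. [folklore] -/
def corr (q : ℝ × EuclideanSpace ℝ (Fin 3)) : ℝ := (2 * π)⁻¹ * Real.arcsin (sn ν₀ β q)

/-- **The straightening map** `Ψ₁ (t, x) = (t + arcsin(sn (t, x))/2π, x)`. [folklore] -/
def Ψ₁ (q : ℝ × EuclideanSpace ℝ (Fin 3)) : ℝ × EuclideanSpace ℝ (Fin 3) := (q.1 + corr ν₀ β q, q.2)

/-- The good region: `‖A‖ = 1` (the tube point lies in `U`) and `cs > 0`. [folklore] -/
def region (U : Set X) : Set (ℝ × EuclideanSpace ℝ (Fin 3)) :=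
  {q | ν₀.toFun (circlePt q.1, q.2) ∈ U ∧ 0 < cs ν₀ β q}

/-! ### Smoothness and periodicity -/

/-- The lifted tube map `(t, x) ↦ ν₀ (circlePt t, x)` is smooth. [folklore] -/
theorem contMDiff_lift : ContMDiff 𝓘(ℝ, ℝ × EuclideanSpace ℝ (Fin 3)) (𝓡 4) ∞
    fun q : ℝ × EuclideanSpace ℝ (Fin 3) => ν₀.toFun (circlePt q.1, q.2) :=
  ν₀.isSmoothEmbedding.contMDiff.comp
    ((contMDiff_circlePt.comp contDiff_fst.contMDiff).prodMk contDiff_snd.contMDiff)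

variable {β} (hβ : ContMDiff (𝓡 4) 𝓘(ℝ, EuclideanSpace ℝ (Fin 2)) ∞ β)
include hβ

/-- `A` is smooth. [folklore] -/
theorem contDiff_A : ContDiff ℝ ∞ (A ν₀ β) := by
  rw [← contMDiff_iff_contDiff]
  exact hβ.comp (contMDiff_lift ν₀)

/-- The coordinates of `A` are smooth. [folklore] -/
theorem contDiff_A_apply (i : Fin 2) : ContDiff ℝ ∞ fun q => A ν₀ β q i :=
  (contDiff_euclidean.1 (contDiff_A ν₀ hβ)) i

/-- `sn` is smooth. [folklore] -/
theorem contDiff_sn : ContDiff ℝ ∞ (sn ν₀ β) := by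
  unfold sn
  have hc : ContDiff ℝ ∞ fun q : ℝ × EuclideanSpace ℝ (Fin 3) => Real.cos (2 * π * q.1) :=
    Real.contDiff_cos.comp (contDiff_const.mul contDiff_fst)
  have hs : ContDiff ℝ ∞ fun q : ℝ × EuclideanSpace ℝ (Fin 3) => Real.sin (2 * π * q.1) :=
    Real.contDiff_sin.comp (contDiff_const.mul contDiff_fst)
  exact (hc.mul (contDiff_A_apply ν₀ hβ 1)).sub (hs.mul (contDiff_A_apply ν₀ hβ 0))

/-- `cs` is continuous. [folklore] -/
theorem continuous_cs : Continuous (cs ν₀ β) := by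
  unfold cs
  have hc : Continuous fun q : ℝ × EuclideanSpace ℝ (Fin 3) => Real.cos (2 * π * q.1) :=
    Real.continuous_cos.comp (continuous_const.mul continuous_fst)
  have hs : Continuous fun q : ℝ × EuclideanSpace ℝ (Fin 3) => Real.sin (2 * π * q.1) :=
    Real.continuous_sin.comp (continuous_const.mul continuous_fst)
  exact (hc.mul (contDiff_A_apply ν₀ hβ 0).continuous).add (hs.mul (contDiff_A_apply ν₀ hβ 1).continuous)

omit hβ in
/-- `A (t + 1, x) = A (t, x)`. [folklore] -/
theorem A_add_one (t : ℝ) (x : EuclideanSpace ℝ (Fin 3)) : A ν₀ β (t + 1, x) = A ν₀ β (t, x) := by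
  simp [A, circlePt_add_one]

omit hβ in
/-- `cos (2π(t+1)) = cos 2πt`. [folklore] -/
theorem cos_add_one (t : ℝ) : Real.cos (2 * π * (t + 1)) = Real.cos (2 * π * t) := by
  rw [mul_add, mul_one, Real.cos_add_two_pi]

omit hβ in
/-- `sin (2π(t+1)) = sin 2πt`. [folklore] -/
theorem sin_add_one (t : ℝ) : Real.sin (2 * π * (t + 1)) = Real.sin (2 * π * t) := by
  rw [mul_add, mul_one, Real.sin_add_two_pi]

omit hβ in
/-- `sn (t + 1, x) = sn (t, x)`. [folklore] -/
theorem sn_add_one (t : ℝ) (x : EuclideanSpace ℝ (Fin 3)) : sn ν₀ β (t + 1, x) = sn ν₀ β (t, x) := by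
  simp only [sn, A_add_one, cos_add_one, sin_add_one]

omit hβ in
/-- `cs (t + 1, x) = cs (t, x)`. [folklore] -/
theorem cs_add_one (t : ℝ) (x : EuclideanSpace ℝ (Fin 3)) : cs ν₀ β (t + 1, x) = cs ν₀ β (t, x) := by
  simp only [cs, A_add_one, cos_add_one, sin_add_one]

omit hβ in
/-- **Equivariance**: `Ψ₁ (t + 1, x) = Ψ₁ (t, x) + (1, 0)`. [folklore] -/
theorem Ψ₁_add_one (t : ℝ) (x : EuclideanSpace ℝ (Fin 3)) : Ψ₁ ν₀ β (t + 1, x) = Ψ₁ ν₀ β (t, x) + (1, 0) := by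
  simp only [Ψ₁, corr, sn_add_one, Prod.mk_add_mk, add_zero]
  congr 1; ring

omit hβ in
/-- `Ψ₁` preserves the normal coordinate. [folklore] -/
@[simp] theorem Ψ₁_snd (q : ℝ × EuclideanSpace ℝ (Fin 3)) : (Ψ₁ ν₀ β q).2 = q.2 := rfl

/-! ### Along the zero section -/

variable (hβe : ∀ u : Metric.sphere (0 : EuclideanSpace ℝ (Fin 2)) 1, β (e u) = (u : EuclideanSpace ℝ (Fin 2)))
include hβe

omit hβ in
/-- `A (t, 0) = (cos 2πt, sin 2πt)`. [folklore] -/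
theorem A_zero (t : ℝ) : A ν₀ β (t, 0) 0 = Real.cos (2 * π * t) ∧ A ν₀ β (t, 0) 1 = Real.sin (2 * π * t) := by
  simp only [A, ν₀.apply_zero, hβe, circlePt_apply_zero, circlePt_apply_one, and_self]

omit hβ in
/-- `sn (t, 0) = 0`. [folklore] -/
theorem sn_zero (t : ℝ) : sn ν₀ β (t, 0) = 0 := by
  rw [sn, (A_zero ν₀ hβe t).1, (A_zero ν₀ hβe t).2]; ring

omit hβ in
/-- `cs (t, 0) = 1`. [folklore] -/
theorem cs_zero (t : ℝ) : cs ν₀ β (t, 0) = 1 := by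
  rw [cs, (A_zero ν₀ hβe t).1, (A_zero ν₀ hβe t).2, ← sq, ← sq, Real.cos_sq_add_sin_sq]

omit hβ in
/-- **`Ψ₁` fixes the zero section.** [folklore] -/
theorem Ψ₁_zero (t : ℝ) : Ψ₁ ν₀ β (t, 0) = (t, 0) := by
  simp [Ψ₁, corr, sn_zero ν₀ hβe, Real.arcsin_zero]

/-! ### On the good region -/

variable {U : Set X} (hU : ∀ x ∈ U, ‖β x‖ = 1)
include hU

omit hβ hβe in
/-- On the region, `sn² + cs² = 1`. [folklore] -/
theorem sn_sq_add_cs_sq {q : ℝ × EuclideanSpace ℝ (Fin 3)} (hq : q ∈ region ν₀ β U) :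
    sn ν₀ β q ^ 2 + cs ν₀ β q ^ 2 = 1 := by
  have h1 : ‖A ν₀ β q‖ ^ 2 = 1 := by rw [A, hU _ hq.1, one_pow]
  have h2 : ‖A ν₀ β q‖ ^ 2 = A ν₀ β q 0 ^ 2 + A ν₀ β q 1 ^ 2 := by
    rw [EuclideanSpace.norm_sq_eq, Fin.sum_univ_two]; simp [sq_abs]
  have h3 := Real.cos_sq_add_sin_sq (2 * π * q.1)
  rw [sn, cs]
  nlinarith [h1, h2, h3]

omit hβ hβe in
/-- On the region, `|sn| < 1`. [folklore] -/
theorem sn_sq_lt_one {q : ℝ × EuclideanSpace ℝ (Fin 3)} (hq : q ∈ region ν₀ β U) : sn ν₀ β q ^ 2 < 1 := by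
  have h := sn_sq_add_cs_sq ν₀ hU hq
  nlinarith [hq.2]

omit hβ hβe in
/-- On the region, `cos (arcsin sn) = cs`. [folklore] -/
theorem cos_arcsin_sn {q : ℝ × EuclideanSpace ℝ (Fin 3)} (hq : q ∈ region ν₀ β U) :
    Real.cos (Real.arcsin (sn ν₀ β q)) = cs ν₀ β q := by
  rw [Real.cos_arcsin]
  have h := sn_sq_add_cs_sq ν₀ hU hq
  rw [show 1 - sn ν₀ β q ^ 2 = cs ν₀ β q ^ 2 by linarith, Real.sqrt_sq hq.2.le]

omit hβ hβe in
/-- **`Ψ₁` straightens `β`**: on the region, `A q = (cos 2πs, sin 2πs)`, `s = (Ψ₁ q).1`. [folklore] -/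
theorem A_eq_of_mem {q : ℝ × EuclideanSpace ℝ (Fin 3)} (hq : q ∈ region ν₀ β U) :
    A ν₀ β q 0 = Real.cos (2 * π * (Ψ₁ ν₀ β q).1) ∧ A ν₀ β q 1 = Real.sin (2 * π * (Ψ₁ ν₀ β q).1) := by
  have hsq := sn_sq_lt_one ν₀ hU hq
  have habs : |sn ν₀ β q| < 1 := by rw [← sq_lt_one_iff_abs_lt_one]; exact hsq
  have hsin : Real.sin (Real.arcsin (sn ν₀ β q)) = sn ν₀ β q :=
    Real.sin_arcsin (by linarith [neg_abs_le (sn ν₀ β q)]) (le_abs_self _ |>.trans habs.le)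
  have hcos := cos_arcsin_sn ν₀ hU hq
  have harg : 2 * π * (Ψ₁ ν₀ β q).1 = 2 * π * q.1 + Real.arcsin (sn ν₀ β q) := by
    simp only [Ψ₁, corr]; field_simp
  have h3 := Real.cos_sq_add_sin_sq (2 * π * q.1)
  rw [harg, Real.cos_add, Real.sin_add, hsin, hcos, cs, sn]
  constructor
  · linear_combination (-(A ν₀ β q 0)) * h3
  · linear_combination (-(A ν₀ β q 1)) * h3

omit hβe in
/-- `corr` is smooth on the region. [folklore] -/
theorem contDiffOn_corr : ContDiffOn ℝ ∞ (corr ν₀ β) (region ν₀ β U) := by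
  intro q hq
  have hsq := sn_sq_lt_one ν₀ hU hq
  have h1 : sn ν₀ β q ≠ -1 := fun h => by rw [h] at hsq; norm_num at hsq
  have h2 : sn ν₀ β q ≠ 1 := fun h => by rw [h] at hsq; norm_num at hsq
  exact (contDiffAt_const.mul ((Real.contDiffAt_arcsin h1 h2).comp q
    (contDiff_sn ν₀ hβ).contDiffAt)).contDiffWithinAt

omit hβe in
/-- `Ψ₁` is smooth on the region. [folklore] -/
theorem contDiffOn_Ψ₁ : ContDiffOn ℝ ∞ (Ψ₁ ν₀ β) (region ν₀ β U) :=
  (contDiffOn_fst.add (contDiffOn_corr ν₀ hβ hU)).prodMk contDiffOn_snd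

omit hβe hU in
/-- The region is open. [folklore] -/
theorem isOpen_region (hUo : IsOpen U) : IsOpen (region ν₀ β U) :=
  (hUo.preimage (contMDiff_lift ν₀).continuous).inter (isOpen_lt continuous_const (continuous_cs ν₀ hβ))

/-! ### The differential along the zero section -/

omit hU in
/-- **The differential of `Ψ₁` at `(t, 0)` is invertible**: `Ψ₁ = id + (h, 0)` with `h = 0` on
the zero section, so `dΨ₁ (τ, ξ) = (τ + dh(0, ξ), ξ)`, with inverse `(σ, ξ) ↦ (σ - dh(0, ξ), ξ)`.
[folklore] -/
theorem isInvertible_fderiv_Ψ₁ (hUo : IsOpen U) (heU : ∀ u, e u ∈ U) (hU : ∀ x ∈ U, ‖β x‖ = 1) (t : ℝ) :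
    (fderiv ℝ (Ψ₁ ν₀ β) (t, 0)).IsInvertible := by
  have hmem : ((t, (0 : EuclideanSpace ℝ (Fin 3))) : ℝ × EuclideanSpace ℝ (Fin 3)) ∈ region ν₀ β U := by
    refine ⟨?_, by rw [cs_zero ν₀ hβe]; exact one_pos⟩
    show ν₀.toFun (circlePt t, 0) ∈ U
    rw [ν₀.apply_zero]; exact heU _
  have hopen := isOpen_region ν₀ hβ hUo
  -- the differential of the correction
  have hcd : DifferentiableAt ℝ (corr ν₀ β) (t, 0) :=
    ((contDiffOn_corr ν₀ hβ hU).differentiableOn (by simp)).differentiableAt (hopen.mem_nhds hmem)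
  set D : ℝ × EuclideanSpace ℝ (Fin 3) →L[ℝ] ℝ := fderiv ℝ (corr ν₀ β) (t, 0) with hD
  -- it kills the horizontal direction, the correction vanishing on the zero section
  have hD0 : ∀ τ : ℝ, D (τ, 0) = 0 := fun τ => by
    have h1 : HasFDerivAt ((corr ν₀ β) ∘ fun s : ℝ => ((s, 0) : ℝ × EuclideanSpace ℝ (Fin 3)))
        (D.comp ((ContinuousLinearMap.id ℝ ℝ).prod (0 : ℝ →L[ℝ] EuclideanSpace ℝ (Fin 3)))) t := by
      refine HasFDerivAt.comp t hcd.hasFDerivAt ?_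
      exact (hasFDerivAt_id t).prodMk (hasFDerivAt_const (0 : EuclideanSpace ℝ (Fin 3)) t)
    have h0 : ((corr ν₀ β) ∘ fun s : ℝ => ((s, 0) : ℝ × EuclideanSpace ℝ (Fin 3))) = fun _ => 0 := by
      funext s; simp [corr, sn_zero ν₀ hβe, Real.arcsin_zero]
    rw [h0] at h1
    have h2 := (hasFDerivAt_const (0 : ℝ) t).unique h1
    have h3 := congrArg (fun L : ℝ →L[ℝ] ℝ => L τ) h2
    simp only [FunLike.coe_zero, Pi.zero_apply, ContinuousLinearMap.comp_apply, ContinuousLinearMap.prod_apply,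
      ContinuousLinearMap.id_apply] at h3
    exact h3.symm
  -- the differential of `Ψ₁`
  have hΨ : HasFDerivAt (Ψ₁ ν₀ β)
      (((ContinuousLinearMap.fst ℝ ℝ (EuclideanSpace ℝ (Fin 3))) + D).prod
        (ContinuousLinearMap.snd ℝ ℝ (EuclideanSpace ℝ (Fin 3)))) (t, 0) :=
    (hasFDerivAt_fst.add hcd.hasFDerivAt).prodMk hasFDerivAt_snd
  rw [hΨ.fderiv]
  set L := ((ContinuousLinearMap.fst ℝ ℝ (EuclideanSpace ℝ (Fin 3))) + D).prod
    (ContinuousLinearMap.snd ℝ ℝ (EuclideanSpace ℝ (Fin 3))) with hL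
  set L' : ℝ × EuclideanSpace ℝ (Fin 3) →L[ℝ] ℝ × EuclideanSpace ℝ (Fin 3) :=
    ((ContinuousLinearMap.fst ℝ ℝ (EuclideanSpace ℝ (Fin 3))) -
      D.comp ((ContinuousLinearMap.inr ℝ ℝ (EuclideanSpace ℝ (Fin 3))).comp
        (ContinuousLinearMap.snd ℝ ℝ (EuclideanSpace ℝ (Fin 3))))).prod
      (ContinuousLinearMap.snd ℝ ℝ (EuclideanSpace ℝ (Fin 3))) with hL'
  have hsplit : ∀ v : ℝ × EuclideanSpace ℝ (Fin 3), D v = D (0, v.2) := fun v => by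
    have : v = (v.1, (0 : EuclideanSpace ℝ (Fin 3))) + ((0 : ℝ), v.2) := by ext <;> simp
    conv_lhs => rw [this]
    rw [map_add, hD0, zero_add]
  have h1 : ∀ v, L' (L v) = v := fun v => by
    obtain ⟨τ, ξ⟩ := v
    simp only [hL, hL', ContinuousLinearMap.prod_apply, FunLike.coe_add, Pi.add_apply,
      ContinuousLinearMap.coe_fst', ContinuousLinearMap.coe_snd', FunLike.coe_sub, Pi.sub_apply,
      ContinuousLinearMap.comp_apply, ContinuousLinearMap.inr_apply, Prod.mk.injEq, and_true]
    rw [hsplit (τ, ξ)]; ring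
  have h2 : ∀ w, L (L' w) = w := fun w => by
    obtain ⟨σ, ξ⟩ := w
    simp only [hL, hL', ContinuousLinearMap.prod_apply, FunLike.coe_add, Pi.add_apply,
      ContinuousLinearMap.coe_fst', ContinuousLinearMap.coe_snd', FunLike.coe_sub, Pi.sub_apply,
      ContinuousLinearMap.comp_apply, ContinuousLinearMap.inr_apply, Prod.mk.injEq, and_true]
    rw [hsplit (σ - D (0, ξ), ξ)]; ring
  exact ⟨ContinuousLinearEquiv.equivOfInverse L L' h1 h2, rfl⟩

/-! ### The uniform tube and the package -/

omit hU in
/-- **Straightening the angular map** (see the module docstring). [cite: HirschDT1976, Ch. 4 §5]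
[cite: BanyagaHurtubise2004, Thm. 2] -/
theorem exists_straighten (hUo : IsOpen U) (heU : ∀ u, e u ∈ U) (hU : ∀ x ∈ U, ‖β x‖ = 1) :
    ∃ (r₁ : ℝ) (Ψ : ℝ × EuclideanSpace ℝ (Fin 3) → ℝ × EuclideanSpace ℝ (Fin 3)), 0 < r₁ ∧
      ContDiffOn ℝ ∞ Ψ (univ ×ˢ ball 0 r₁) ∧ (∀ t : ℝ, Ψ (t, 0) = (t, 0)) ∧
      (∀ (t : ℝ) (x : EuclideanSpace ℝ (Fin 3)), Ψ (t + 1, x) = Ψ (t, x) + (1, 0)) ∧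
      (∀ t : ℝ, (fderiv ℝ Ψ (t, 0)).IsInvertible) ∧ (∀ q, (Ψ q).2 = q.2) ∧
      ∀ q ∈ univ ×ˢ ball (0 : EuclideanSpace ℝ (Fin 3)) r₁,
        β (ν₀.toFun (circlePt q.1, q.2)) 0 = Real.cos (2 * π * (Ψ q).1) ∧
          β (ν₀.toFun (circlePt q.1, q.2)) 1 = Real.sin (2 * π * (Ψ q).1) := by
  have hopen := isOpen_region ν₀ hβ hUo (U := U)
  have h0 : ∀ t : ℝ, ((t, (0 : EuclideanSpace ℝ (Fin 3))) : ℝ × EuclideanSpace ℝ (Fin 3)) ∈ region ν₀ β U :=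
    fun t => ⟨show ν₀.toFun (circlePt t, 0) ∈ U by rw [ν₀.apply_zero]; exact heU _,
      by rw [cs_zero ν₀ hβe]; exact one_pos⟩
  have hper : ∀ (t : ℝ) (x : EuclideanSpace ℝ (Fin 3)), ((t, x) : ℝ × EuclideanSpace ℝ (Fin 3)) ∈ region ν₀ β U →
      ((t + 1, x) : ℝ × EuclideanSpace ℝ (Fin 3)) ∈ region ν₀ β U := fun t x h => by
    refine ⟨?_, ?_⟩
    · show ν₀.toFun (circlePt (t + 1), x) ∈ U
      rw [circlePt_add_one]; exact h.1
    · rw [cs_add_one]; exact h.2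
  have hper' : ∀ (t : ℝ) (x : EuclideanSpace ℝ (Fin 3)), ((t, x) : ℝ × EuclideanSpace ℝ (Fin 3)) ∈ region ν₀ β U →
      ((t - 1, x) : ℝ × EuclideanSpace ℝ (Fin 3)) ∈ region ν₀ β U := fun t x h => by
    have h' := h
    rw [show t = (t - 1) + 1 by ring] at h'
    refine ⟨?_, ?_⟩
    · show ν₀.toFun (circlePt (t - 1), x) ∈ U
      have := h'.1
      change ν₀.toFun (circlePt (t - 1 + 1), x) ∈ U at this
      rwa [circlePt_add_one] at this
    · have := h'.2
      rwa [cs_add_one] at this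
  obtain ⟨r₁, hr₁, hball⟩ := exists_ball_subset_of_forall_add hopen h0 one_pos hper hper'
  refine ⟨r₁, Ψ₁ ν₀ β, hr₁, (contDiffOn_Ψ₁ ν₀ hβ hU).mono ?_, Ψ₁_zero ν₀ hβe, Ψ₁_add_one ν₀,
    isInvertible_fderiv_Ψ₁ ν₀ hβ hβe hUo heU hU, Ψ₁_snd ν₀, fun q hq => A_eq_of_mem ν₀ hU (hball q.1 q.2 hq.2)⟩
  rintro ⟨t, x⟩ ⟨-, hx⟩
  exact hball t x hx

end BottStraighten

end Summit.SmoothPoincare4.SmoothPoincare4.Cruxes.RungOne.Sketch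

end
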